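import Summits.BirchSwinnertonDyer.BirchSwinnertonDyer.Theorems.ManinLocalTwoThreeManinPrimeToThreeAtNineOfOrdJLeZero
import Summits.BirchSwinnertonDyer.Rank1Residual.ManinAdditive.CuspidalKummerCubeLaws
import Literature.NumberTheory.EllipticCurves.OggFormulaTypeIstarProofs
import Literature.NumberTheory.EllipticCurves.GlobalMinimalModelProofs
import Literature.NumberTheory.EllipticCurves.IsogenyVariableChangeProofs
import Literature.NumberTheory.EllipticCurves.RootNumberSmulProofs
import Literature.NumberTheory.EllipticCurves.NeronLocalHeightCompletion
import HarnessLib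

/-!
# The three C3 CORE binders are FREE at every datum that admits no semistable ternary untwist — the glue the C3 LEAD asked for
# (Q-p1-g13-1): `RES₃♭` ⟸ `RES₃♭` read on the core, POINTWISE, no isogeny-invariance fact (route `ManinLocalTwoThree`, crux C3
# stmt-BirchSwinnertonDyer-22968; cell bsd-f2-manin, p2 gen 15)

The C3 skeleton of record (`Cruxes/ManinPrimeToThreeAtNine/Lines/kato_shift_three.lean` v18) applies its residual law RES₃♭
(`CuspidalKummerThree.NoRationalThreeTorsionCoprimeIsolatedResidual`) AT a lattice-optimal `X₀(N)`-datum whose clause 1 says «no globally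
minimal `W′` with `W ∼ W′ ⊗ ℚ(√−3)` and `9 ∤ N(W′)`».  This file proves that clause 1 alone (with `9 ∣ N = N(W)` from modularity) already
yields, AT THE SAME CURVE, this seat's three core binders of `maninPrimeToThreeAtNine_of_core`:
* (a) `|j(W)|₃ < 1` (potentially supersingular) — else the local law `isSemistableAt_quadraticTwist_negThree_of_one_le_valuation_j_of_hasAdditiveReductionAt`
  (p706475) makes `W ⊗ (−3)` semistable at `3`, and a global minimal model `W′` of `W ⊗ (−3)` is a clause-1 partner
  (`W′ ⊗ (−3) ≅ W ⊗ 9 ≅ W`, `f₃(W′) ≤ 1`) — `exists_ternarySemistableUntwist_of_not_hasAdditiveReductionAt_quadraticTwist_negThree`;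
* (c) `W ⊗ ℚ(√−3)` additive at `3` — the same construction;
* (b) Kodaira type at `3` among `II, III, IV, IV*, III*, II*` — `I₀*` resp. `Iₙ≥1*` would make the twist by `−3 = 3*` good
  (`hasGoodReductionAt_quadraticTwist_of_kodairaSymbolAt_eq_Istar_zero`) resp. multiplicative
  (`hasMultiplicativeReductionAt_quadraticTwist_pStar_of_kodairaSymbolAt_eq_Istar_succ`), against (c).
Hence `noRationalThreeTorsionCoprimeIsolatedResidual_of_core`: **RES₃♭ with the three binders inserted after clause 1 (the shape of a
v19 stub) implies RES₃♭ verbatim, given modularity `exists_isNewformOf`** — the potentially-supersingular binder is never transported along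
the descent (where it would need «potential supersingularity is an isogeny invariant», not in the tree); it is re-derived at the partner.
HONEST FRAMING: bookkeeping glue; RES₃♭ (on the core or not) is an OPEN residual of Manin's conjecture at `3`; nothing about BSD or C3 is
proved here.  No definitions, no named facts, no sorry.
[cite: Stevens1989, Lemmas (5.2), (5.4)] [cite: SilvermanAEC2009, VII.5 Prop. 5.1 and X.5 Cor. 5.4.1] [cite: SilvermanATAEC1994, IV.9.4 Table 4.1 and IV.11.1 (p = 3)]
-/

set_option autoImplicit false
-- lint-debt: the directory name repeats the summit name (sibling precedent `ManinLocalTwoThreeManinPrimeToThreeAtNineOfOrdJLeZero.lean`)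
set_option linter.dupNamespace false

noncomputable section

open scoped Classical
open WeierstrassCurve IsDedekindDomain IsDedekindDomain.HeightOneSpectrum Rat.HeightOneSpectrum PowerSeries CongruenceSubgroup
  Literature.NumberTheory.DiophantineGeometry Literature.NumberTheory.EllipticCurves
  Literature.NumberTheory.EllipticCurves.ModularForms
  Summit.BirchSwinnertonDyer.Rank1Residual.Additive
  Summit.BirchSwinnertonDyer.Rank1Residual.ManinAdditive.CuspidalKummer
  Summit.BirchSwinnertonDyer.Rank1Residual.ManinAdditive.CuspidalKummerThree

namespace Summit.BirchSwinnertonDyer.BirchSwinnertonDyer.Theorems.ManinLocalTwoThree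

/-! ## §1 The clause-1 partner from a semistable ternary twist, and the three binders -/

/-- **A semistable ternary twist IS a clause-1 partner.**  If `W ⊗ ℚ(√−3)` is NOT additive at `3`, then a global minimal model `W′` of it
is globally minimal, `W ∼ W′ ⊗ ℚ(√−3)` (indeed `≅`: `W′ ⊗ (−3) ≅ (W ⊗ (−3)) ⊗ (−3) = W ⊗ 9 ≅ W`) and `9 ∤ N(W′)` (`f₃(W′) = f₃(W ⊗ (−3)) ≤ 1`).
[cite: SilvermanAEC2009, X.5 Cor. 5.4] [cite: SilvermanATAEC1994, IV.10.2] -/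
theorem exists_ternarySemistableUntwist_of_not_hasAdditiveReductionAt_quadraticTwist_negThree
    (W : WeierstrassCurve ℚ) [W.IsElliptic]
    (htw : ¬ (haveI := W.isElliptic_quadraticTwist (show ((-3 : ℤ) : ℚ) ≠ 0 by norm_num);
      (W.quadraticTwist ((-3 : ℤ) : ℚ)).HasAdditiveReductionAt (placeOf 3))) :
    ∃ (W' : WeierstrassCurve ℚ) (d : ℤ), W'.IsElliptic ∧ W'.IsGloballyMinimal ∧
      (d = -3) ∧ IsIsogenous W (W'.quadraticTwist (d : ℚ)) ∧ ¬ 3 ^ 2 ∣ W'.conductorNorm ℤ := by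
  haveI : PerfectField (IsLocalRing.ResidueField ((placeOf 3).adicCompletionIntegers ℚ)) := PerfectField.ofFinite
  have hd0 : ((-3 : ℤ) : ℚ) ≠ 0 := by norm_num
  haveI := W.isElliptic_quadraticTwist hd0
  -- a global minimal model `W'` of `W ⊗ (−3)`
  obtain ⟨C₁, hC₁⟩ := hasGlobalMinimalModel_rat_holds (W.quadraticTwist ((-3 : ℤ) : ℚ))
  haveI := hC₁
  set W' : WeierstrassCurve ℚ := C₁ • W.quadraticTwist ((-3 : ℤ) : ℚ) with hW'
  haveI := W'.isElliptic_quadraticTwist hd0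
  refine ⟨W', -3, inferInstance, hC₁, rfl, ?_, ?_⟩
  · -- `W' ⊗ (−3) ≅ W`
    obtain ⟨C₂, hC₂⟩ := W.exists_variableChange_quadraticTwist_mul_sq 1 ((-3 : ℤ) : ℚ) hd0
    obtain ⟨C₃, hC₃⟩ := W.exists_variableChange_quadraticTwist_one
    have hWW' : W'.quadraticTwist ((-3 : ℤ) : ℚ) = ((⟨C₁.u, ((-3 : ℤ) : ℚ) * C₁.r, 0, 0⟩ : VariableChange ℚ) * C₂ * C₃) • W := by
      rw [mul_smul, mul_smul, hC₃, hC₂, hW', WeierstrassCurve.quadraticTwist_smul, quadraticTwist_quadraticTwist]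
      congr 2
      ring
    rw [hWW']
    exact isIsogenous_smul W _
  · -- `9 ∤ N(W')`: `f₃(W') = f₃(W ⊗ (−3)) ≤ 1`
    intro h9
    have hfac : (W'.conductorNorm ℤ).factorization 3 = W'.conductorExponent (placeOf 3) :=
      factorization_conductorNorm_primesEquiv_symm W' ⟨3, Nat.prime_three⟩
    have h2 : 2 ≤ W'.conductorExponent (placeOf 3) := by
      rw [← hfac]; exact (Nat.prime_three.pow_dvd_iff_le_factorization (W'.conductorNorm_pos_holds).ne').mp h9
    rw [hW', conductorExponent_smul'] at h2
    exact htw ((two_le_conductorExponent_iff_holds (placeOf 3) _).mp h2)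

/-- **The three core binders are free at a curve with no semistable ternary untwist.**  For a globally minimal `W` with `9 ∣ N(W)` such that
NO globally minimal `W′` has `W ∼ W′ ⊗ ℚ(√−3)` and `9 ∤ N(W′)` (clause 1 of RES₃′/RES₃♭): (a) `|j(W)|₃ < 1`, (b) the Kodaira type of `W` at `3`
is `II, III, IV, IV*, III*` or `II*`, (c) `W ⊗ ℚ(√−3)` is additive at `3`.
[cite: SilvermanAEC2009, VII.5 Prop. 5.1 and X.5 Cor. 5.4.1] [cite: SilvermanATAEC1994, IV.9.4 Table 4.1 and IV.11.1 (p = 3)] -/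
theorem coreBinders_of_noTernarySemistableUntwist (W : WeierstrassCurve ℚ) [W.IsElliptic] [W.IsGloballyMinimal]
    (h9 : 3 ^ 2 ∣ W.conductorNorm ℤ)
    (h1 : ¬ (∃ (W' : WeierstrassCurve ℚ) (d : ℤ), W'.IsElliptic ∧ W'.IsGloballyMinimal ∧
      (d = -3) ∧ IsIsogenous W (W'.quadraticTwist (d : ℚ)) ∧ ¬ 3 ^ 2 ∣ W'.conductorNorm ℤ)) :
    (placeOf 3).valuation ℚ W.j < 1 ∧
      (W.kodairaSymbolAt (placeOf 3) = .II ∨ W.kodairaSymbolAt (placeOf 3) = .III ∨ W.kodairaSymbolAt (placeOf 3) = .IV ∨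
        W.kodairaSymbolAt (placeOf 3) = .IVstar ∨ W.kodairaSymbolAt (placeOf 3) = .IIIstar ∨ W.kodairaSymbolAt (placeOf 3) = .IIstar) ∧
      (haveI := W.isElliptic_quadraticTwist (show ((-3 : ℤ) : ℚ) ≠ 0 by norm_num);
        (W.quadraticTwist ((-3 : ℤ) : ℚ)).HasAdditiveReductionAt (placeOf 3)) := by
  haveI : PerfectField (IsLocalRing.ResidueField ((placeOf 3).adicCompletionIntegers ℚ)) := PerfectField.ofFinite
  have hd0 : ((-3 : ℤ) : ℚ) ≠ 0 := by norm_num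
  haveI := W.isElliptic_quadraticTwist hd0
  have hgen : natGenerator (placeOf 3) = 3 := congrArg Subtype.val ((primesEquiv (R := ℤ)).apply_symm_apply ⟨3, Nat.prime_three⟩)
  -- `W` is additive at `3`
  have hadd : W.HasAdditiveReductionAt (placeOf 3) := by
    have hfac : (W.conductorNorm ℤ).factorization 3 = W.conductorExponent (placeOf 3) :=
      factorization_conductorNorm_primesEquiv_symm W ⟨3, Nat.prime_three⟩
    refine (two_le_conductorExponent_iff_holds (placeOf 3) W).mp ?_
    rw [← hfac]
    exact (Nat.prime_three.pow_dvd_iff_le_factorization (W.conductorNorm_pos_holds).ne').mp h9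
  -- (c) the ternary twist is additive
  have hc : (W.quadraticTwist ((-3 : ℤ) : ℚ)).HasAdditiveReductionAt (placeOf 3) := by
    by_contra htw
    exact h1 (exists_ternarySemistableUntwist_of_not_hasAdditiveReductionAt_quadraticTwist_negThree W htw)
  refine ⟨?_, ?_, hc⟩
  · -- (a) `|j|₃ < 1`
    by_contra hj
    rcases isSemistableAt_quadraticTwist_negThree_of_one_le_valuation_j_of_hasAdditiveReductionAt (placeOf 3) hgen W
        (not_lt.mp hj) hadd with hg | hm
    · exact hc.not_hasGoodReductionAt hg
    · exact hc.not_hasMultiplicativeReductionAt hm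
  · -- (b) the additive type is not `Iₙ*`
    have hK : (W.kodairaSymbolAt (placeOf 3)).IsAdditive := (isAdditive_kodairaSymbolAt_iff_holds (placeOf 3) W).mpr hadd
    have h2 : ringChar (ℤ ⧸ (placeOf 3).asIdeal) ≠ 2 := by rw [ringChar_int_quot_placeOf 3]; decide
    have hnotI : ∀ n : ℕ, W.kodairaSymbolAt (placeOf 3) ≠ .Istar n := by
      intro n hKn
      rcases n with _ | n
      · -- `I₀*`: the twist by `−3` (a uniformiser at `3`) has good reduction
        have hπ : (placeOf 3).valuation ℚ ((-3 : ℤ) : ℚ) = WithZero.exp (-1 : ℤ) := by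
          have h := valuation_natGenerator_int (placeOf 3)
          rw [hgen] at h
          rw [Int.cast_neg, Valuation.map_neg]
          exact_mod_cast h
        exact hc.not_hasGoodReductionAt (W.hasGoodReductionAt_quadraticTwist_of_kodairaSymbolAt_eq_Istar_zero (placeOf 3) h2 hKn hπ)
      · -- `Iₙ₊₁*`: the twist by `3* = −3` is multiplicative
        have hm := hasMultiplicativeReductionAt_quadraticTwist_pStar_of_kodairaSymbolAt_eq_Istar_succ (W := W) Nat.prime_three
          (by decide) hKn
        have h3 : (((-1 : ℤ) ^ (3 / 2) * (3 : ℕ) : ℤ) : ℚ) = ((-3 : ℤ) : ℚ) := by norm_num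
        rw [h3] at hm
        exact hc.not_hasMultiplicativeReductionAt hm
    rcases eq_of_isAdditive hK with h | h | h | ⟨n, h⟩ | h | h | h
    · exact Or.inl h
    · exact Or.inr (Or.inl h)
    · exact Or.inr (Or.inr (Or.inl h))
    · exact absurd h (hnotI n)
    · exact Or.inr (Or.inr (Or.inr (Or.inl h)))
    · exact Or.inr (Or.inr (Or.inr (Or.inr (Or.inl h))))
    · exact Or.inr (Or.inr (Or.inr (Or.inr (Or.inr h))))

/-! ## §2 RES₃♭ from RES₃♭ read on the core -/

/-- **RES₃♭ ⟸ RES₃♭-on-the-core, given modularity.**  If the residual law `NoRationalThreeTorsionCoprimeIsolatedResidual` holds for the data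
that additionally satisfy the three core binders (`|j|₃ < 1`; Kodaira type `II/III/IV/IV*/III*/II*` at `3`; `W ⊗ ℚ(√−3)` additive at `3`) —
the shape of a v19 stub —, then it holds verbatim: at any datum with `9 ∣ N = N(W)` (`exists_isNewformOf`) satisfying clause 1 the binders
hold by `coreBinders_of_noTernarySemistableUntwist`.  [cite: Stevens1989, Lemmas (5.2), (5.4)] [cite: SilvermanATAEC1994, IV.11.1 (p = 3)] -/
theorem noRationalThreeTorsionCoprimeIsolatedResidual_of_core (hnf : exists_isNewformOf)
    (hcore :
    ∀ (W : WeierstrassCurve ℚ) [W.IsElliptic] [W.IsGloballyMinimal] {N : ℕ} [NeZero N]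
      (D : ModularParametrizationData W N),
      (∀ z ∈ D.L.lattice, ∃ w ∈ periodLattice D.f, z = D.c * w) → 3 ^ 2 ∣ N →
      ¬ (∃ (W' : WeierstrassCurve ℚ) (d : ℤ), W'.IsElliptic ∧ W'.IsGloballyMinimal ∧
        (d = -3) ∧ IsIsogenous W (W'.quadraticTwist (d : ℚ)) ∧
        ¬ 3 ^ 2 ∣ W'.conductorNorm ℤ) →
      -- the three CORE binders (free at this datum: `coreBinders_of_noTernarySemistableUntwist`)
      (placeOf 3).valuation ℚ W.j < 1 →
      (W.kodairaSymbolAt (placeOf 3) = .II ∨ W.kodairaSymbolAt (placeOf 3) = .III ∨ W.kodairaSymbolAt (placeOf 3) = .IV ∨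
        W.kodairaSymbolAt (placeOf 3) = .IVstar ∨ W.kodairaSymbolAt (placeOf 3) = .IIIstar ∨ W.kodairaSymbolAt (placeOf 3) = .IIstar) →
      (haveI := W.isElliptic_quadraticTwist (show ((-3 : ℤ) : ℚ) ≠ 0 by norm_num);
        (W.quadraticTwist ((-3 : ℤ) : ℚ)).HasAdditiveReductionAt (placeOf 3)) →
      ¬ (∃ (W' : WeierstrassCurve ℚ) (q : ℕ), W'.IsElliptic ∧ W'.IsGloballyMinimal ∧
        q.Prime ∧ q ≠ 2 ∧ q ≠ 3 ∧ q ^ 2 ∣ N ∧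
        IsIsogenous W (W'.quadraticTwist (((-1 : ℤ) ^ (q / 2) * q : ℤ) : ℚ)) ∧
        ¬ q ^ 2 ∣ W'.conductorNorm ℤ) →
      ¬ (∃ (W' : WeierstrassCurve ℚ) (d : ℤ), W'.IsElliptic ∧ W'.IsGloballyMinimal ∧
        (d = -1 ∨ d = 2 ∨ d = -2) ∧ 2 ^ 2 ∣ N ∧ IsIsogenous W (W'.quadraticTwist (d : ℚ)) ∧
        ¬ 2 ^ 2 ∣ W'.conductorNorm ℤ) →
      ¬ (∃ (A : WeierstrassCurve ℚ), A.IsElliptic ∧ A.IsGloballyMinimal ∧ 2 ^ 4 ∣ N ∧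
        2 ^ 2 ∣ A.conductorNorm ℤ ∧ A.conductorNorm ℤ ∣ N ∧ A.conductorNorm ℤ < N ∧
        IsIsogenous W (A.quadraticTwist ((-1 : ℤ) : ℚ))) →
      ¬ (∃ (A : WeierstrassCurve ℚ) (_ : A.IsElliptic) (_ : A.IsGloballyMinimal) (N' : ℕ) (_ : NeZero N')
        (D' : ModularParametrizationData A N') (d : ℤ) (C : WeierstrassCurve ℚ) (u : VariableChange ℚ),
        C.IsElliptic ∧ C.IsGloballyMinimal ∧
        (∀ z ∈ D'.L.lattice, ∃ w ∈ periodLattice D'.f, z = D'.c * w) ∧ (d = 2 ∨ d = -2) ∧ 2 ^ 6 ∣ N ∧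
        2 ^ 2 ∣ A.conductorNorm ℤ ∧ A.conductorNorm ℤ ∣ N ∧
        IsIsogenous W (A.quadraticTwist (d : ℚ)) ∧ u • A.quadraticTwist (d : ℚ) = C ∧
        C.Δ = (d : ℚ) ^ 6 * A.Δ ∧
        (A.conductorNorm ℤ < N ∨ A.minimalDiscriminantInt.natAbs < W.minimalDiscriminantInt.natAbs)) →
      ¬ (∃ (A : WeierstrassCurve ℚ) (_ : A.IsElliptic) (_ : A.IsGloballyMinimal)
        (D' : ModularParametrizationData A N) (q : ℕ) (C : WeierstrassCurve ℚ) (u : VariableChange ℚ),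
        C.IsElliptic ∧ C.IsGloballyMinimal ∧
        (∀ z ∈ D'.L.lattice, ∃ w ∈ periodLattice D'.f, z = D'.c * w) ∧ q.Prime ∧ q ≠ 2 ∧ q ^ 2 ∣ N ∧
        IsIsogenous C W ∧ u • A.quadraticTwist (((-1 : ℤ) ^ (q / 2) * q : ℤ) : ℚ) = C ∧
        C.Δ = ((((-1 : ℤ) ^ (q / 2) * q : ℤ)) : ℚ) ^ 6 * A.Δ ∧
        A.minimalDiscriminantInt.natAbs < W.minimalDiscriminantInt.natAbs) →
      -- clause 7 (NEW, an g20): no same-3-level coprime twist partner (q² ∣ N_W: W additive at q) with a rational short 3-torsion point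
      ¬ (∃ (A : WeierstrassCurve ℚ) (_ : A.IsElliptic) (_ : A.IsGloballyMinimal) (N' : ℕ) (_ : NeZero N')
        (D' : ModularParametrizationData A N') (q : ℕ) (C : WeierstrassCurve ℚ) (u : VariableChange ℚ) (X₀ Y₀ : ℚ),
        C.IsElliptic ∧ C.IsGloballyMinimal ∧
        (∀ z ∈ D'.L.lattice, ∃ w ∈ periodLattice D'.f, z = D'.c * w) ∧ N' ∣ N ∧ 9 ∣ N' ∧
        q.Prime ∧ q ≠ 2 ∧ q ≠ 3 ∧ q ^ 2 ∣ N ∧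
        q ^ 2 ∣ W.conductorNorm ℤ ∧
        IsIsogenous C W ∧ u • A.quadraticTwist (((-1 : ℤ) ^ (q / 2) * q : ℤ) : ℚ) = C ∧
        (C.Δ = ((((-1 : ℤ) ^ (q / 2) * q : ℤ)) : ℚ) ^ 6 * A.Δ ∨
          (q : ℚ) ^ 12 * C.Δ = ((((-1 : ℤ) ^ (q / 2) * q : ℤ)) : ℚ) ^ 6 * A.Δ) ∧
        IsShortThreeTorsion A D'.c X₀ Y₀) →
      ¬ W.HasIrreducibleModPGaloisRep 3 → (∀ X₀ Y₀ : ℚ, ¬ IsShortThreeTorsion W D.c X₀ Y₀) → ¬ (3 : ℤ) ∣ D.c) :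
    NoRationalThreeTorsionCoprimeIsolatedResidual := by
  intro W _ _ N _ D hopt h9 h1 h2 h3 h4 h5 h6 h7 hred hT
  have hN : N = W.conductorNorm ℤ := IsNewformOf.level_eq_conductorNorm_of_exists_isNewformOf hnf D.isNewformOf
  obtain ⟨ha, hb, hc⟩ := coreBinders_of_noTernarySemistableUntwist W (hN ▸ h9) h1
  exact hcore W D hopt h9 h1 ha hb hc h2 h3 h4 h5 h6 h7 hred hT

end Summit.BirchSwinnertonDyer.BirchSwinnertonDyer.Theorems.ManinLocalTwoThree

end
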